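import Summits.QuantumFields.BalabanUV.Beta.GAN24.Lin4LegTowerTwo
import Summits.QuantumFields.BalabanUV.Beta.GAN24.T2UnitSplitLevels

/-!
# `BalabanUV.Beta.GAN24.Lin4LegTowerUnroll` — binder row G-an2-4 ∕ (CONV-C), CT-W, located crux (Q-L) («QL-LL», RULING R-gan24p1-g25-1 R10 (iii)):
# «(REP-leg)» part 3 — THE m-FOLD (UNROLLED) FORM OF THE RIGHT-DIVERGENCED LEG TOWER over leaf-01's discrete Duhamel engine `AffineUnroll`
# (G-an2-4 formalisation swarm, leaf prover `b2b-balaban-gan24-formalise-leaf-03`, gen 60; continues `GAN24/Lin4LegTower{,Two}`; name PROVISIONAL)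

NOT IN PRINT; OUR BOOKKEEPING.  HONEST FRAMING (cell contract, verbatim): «discharging `BetaPertH` makes Bałaban's UV stability
UNCONDITIONAL — a real constructive-QFT result; it is NOT the continuum limit and NOT the Clay problem.»  HONEST DEPENDENCY (verbatim):
«continuum YM on T⁴ ⇐ BetaPertH ∧ nine spine estimates (0/9 proved); BetaPertH ⇐ (D1) ∧ (D4) ∧ CAP+tail; G-an2-4 gates asym, D1 and
NE2/3/4.»

WHAT ([folklore]; one plumbing `def`; 0 cite, 0 `def … : Prop`, 0 sorry).  For a tower of affine steps `T (n+1) = lin4 (c n) (K n) N (T n) + F n` (every `K n`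
decaying with its (hH)∕(hM♯) laws, `T 0` and every `F n` bounded) the right-divergenced members `Δ n := fun s ↦ rdiv (T n s)` obey part 1's closed one-step law
`Δ (n+1) = A n (Δ n) + rdiv ∘ F n` with `A n := legStepB kc K N n := fun W s ↦ legStep (kc n) (K n) (K n) N (fun s ↦ bsum N (W s)) s` (`𝓛_n ∘ 𝔹`); the maps
`A n` preserve the bounded class and are additive on it (parts 1∕2), so leaf-01's `AffineUnroll.eq_transport_add_sum` unrolls the tower:
* §1 `legStepB`; the bounded class `∃ B, |W …| ≤ B` is leaf-01's class of record (`T2UnitSplitLevels.bdd₄_zero ∕ bdd₄_add` BY NAME) — closure under `rdiv`, `bsum`, the step maps; §2 **`rdiv_tower_unrolled`**: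
  `Δ n = transport A 0 n (Δ 0) + Σ_{m < n} transport A (m+1) (n−1−m) (rdiv ∘ F m)` — WARD6 (9.1)'s m-fold form with EVERY composite leg transport displayed,
  NO CROSS TERMS; the comb instance `rdiv_tower_unrolled_comb` (`K n = K♮ᴱ_n`, `N = Lc`, `kc n = −(c n·(Lc^{d+1})⁻¹)`).
* §3 **`transport_legStepB_eq`** — `𝔹` COMMUTES OUT OF THE CHAIN: on the bounded class `transport A m k W = legChain kc K N m k (fun s ↦ bsumPow N k (W s))`, the pure
  chain `𝓛_{m+k−1} ∘ ⋯ ∘ 𝓛_m` applied to the `k`-fold block sum `bsumPow N k = bsum N ∘ ⋯ ∘ bsum N = bsum (N^k)` (part 2's `bsum_mul`) — «`𝓛_j𝔹 ⋯ 𝓛_{i+1}𝔹 =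
  (𝓛_j ⋯ 𝓛_{i+1}) ∘ 𝔹^{(j−i)}`», the super-block flux letters of side `N^k`.
Asserts NO norm of any chain ((WIN-k₀)), nothing of (LAY-leg)∕(LT-leg)∕(GRON-k₀), NOT (Q-L-k₀) — OPEN; discharges NOTHING of (Q-L) ∕ (Q-R) ∕ (C) ∕ «T2Shape» ∕ «T2Drift» ∕
(hW, hWall); 0 wall binders; NEVER «G-an2-4 closed» as (CONV-C); NOT D1, NOT `BetaPertH`, NOT continuum, NOT Clay; not in print.
Unit `b2b-balaban-gan24-formalise-leaf-03` (gen 60), 2026-08-22.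
-/

noncomputable section
open Finset
open scoped BigOperators
open Literature.MathematicalPhysics.QuantumFieldTheory
open Literature.MathematicalPhysics.QuantumFieldTheory.Balaban1983to89
open Literature.MathematicalPhysics.QuantumFieldTheory.Balaban1983to89.Beta
open B6BondElimination (unitVec)
open ExpKernelCalculus (MKer Site Decays comp)
open OneStepResolventKernel (Fib)
open OneStepKernelFamily (colH KInvStep)
open KernelWard (Bdd)
open AffineAveraging (box toSite)
open Summit.QuantumFields.BalabanUV.Beta.KernelWardRelative (gaugeWt)
open Summit.QuantumFields.BalabanUV.Beta.GAN24.T2RecursionAffine (lin4)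
open Summit.QuantumFields.BalabanUV.Beta.HessKerDressedUnits (unitK decays_unitK)
open Summit.QuantumFields.BalabanUV.Beta.GAN24.CombesThomas (sfStep smStep)
open Summit.QuantumFields.BalabanUV.Beta.AxialDressingRooted (coDressKBmAt one_le_of_neZero decays_coDressKBmAt_KInvStep)
open Summit.QuantumFields.BalabanUV.Beta.GAN24.Lin4SlotDivergence (hH_unitK_comb)
open Summit.QuantumFields.BalabanUV.Beta.GAN24.Lin4LegDivergence (hM_unitK_comb)
open Summit.QuantumFields.BalabanUV.Beta.GAN24.Lin4LegTower
open Summit.QuantumFields.BalabanUV.Beta.GAN24.Lin4LegTowerTwo (bdd_bsum bdd_legStep legStep_add' bsum_mul)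
open Summit.QuantumFields.BalabanUV.Beta.GAN24.AffineUnroll (transport transport_zero transport_succ eq_transport_add_sum transport_mem)
open Summit.QuantumFields.BalabanUV.Beta.GAN24.T2UnitSplitLevels (bdd₄_zero bdd₄_add)

namespace Summit.QuantumFields.BalabanUV.Beta.GAN24.Lin4LegTowerUnroll

variable {d : ℕ}

/-! ## §1 The step maps `𝓛_n ∘ 𝔹` and the bounded class -/

/-- [folklore] Plumbing `def`: **THE LEVEL-`n` STEP MAP OF THE LEG TOWER**, `legStepB kc K N n W s := legStep (kc n) (K n) (K n) N (fun s ↦ bsum N (W s)) s`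
(`𝓛_n ∘ 𝔹`: block-sum the position index, then the one-step leg map of part 1). -/
def legStepB (kc : ℕ → ℝ) (K : ℕ → MKer (d + 1) (Fib d)) (N : ℕ) (n : ℕ)
    (W : Fin (d + 1) → (Fin (d + 1) → ℤ) → Fin (d + 1) → (Fin (d + 1) → ℤ) → MKer (d + 1) (Fib d)) :
    Fin (d + 1) → (Fin (d + 1) → ℤ) → Fin (d + 1) → (Fin (d + 1) → ℤ) → MKer (d + 1) (Fib d) :=
  fun κ u κ' u' => legStep (kc n) (K n) (K n) N (fun κ u κ' u' => bsum N (W κ u κ' u')) κ u κ' u'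

/-- [folklore] `rdiv ∘` a bounded table is bounded. -/
theorem bddTab_rdiv {T : Fin (d + 1) → (Fin (d + 1) → ℤ) → Fin (d + 1) → (Fin (d + 1) → ℤ) → MKer (d + 1) (Fib d)} (hT : ∃ B : ℝ, ∀ κ u κ' u' x z a b, |T κ u κ' u' x z a b| ≤ B) :
    ∃ B : ℝ, ∀ κ u κ' u' x z a b, |(fun κ u κ' u' => rdiv (T κ u κ' u')) κ u κ' u' x z a b| ≤ B := by
  obtain ⟨B, hB⟩ := hT
  exact ⟨((d + 1 : ℕ) : ℝ) * (B + B), fun κ u κ' u' x z a b => bdd_rdiv (fun x z a b => hB κ u κ' u' x z a b) x z a b⟩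

variable {N : ℕ} {kc : ℕ → ℝ} {K : ℕ → MKer (d + 1) (Fib d)}

/-- [folklore] **THE STEP MAPS PRESERVE THE BOUNDED CLASS** (every `K n` decaying at some rate `δ > 0`; parts 1∕2's `bdd_bsum`, `bdd_legStep`). -/
theorem bddTab_legStepB (hK : ∀ n, ∃ δ C : ℝ, 0 < δ ∧ Decays (K n) C δ) (n : ℕ)
    {W : Fin (d + 1) → (Fin (d + 1) → ℤ) → Fin (d + 1) → (Fin (d + 1) → ℤ) → MKer (d + 1) (Fib d)} (hW : ∃ B : ℝ, ∀ κ u κ' u' x z a b, |W κ u κ' u' x z a b| ≤ B) :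
    ∃ B : ℝ, ∀ κ u κ' u' x z a b, |legStepB kc K N n W κ u κ' u' x z a b| ≤ B := by
  obtain ⟨δ, C, hδ, hKn⟩ := hK n
  obtain ⟨B, hB⟩ := hW
  exact ⟨_, fun κ u κ' u' x z a b => bdd_legStep hKn hδ hKn hδ (kc n) (N := N)
    (fun κ u κ' u' x z a b => bdd_bsum N (fun x z a b => hB κ u κ' u' x z a b) x z a b) κ u κ' u' x z a b⟩

/-- [folklore] **THE STEP MAPS ARE ADDITIVE ON THE BOUNDED CLASS** (`bsum_add` pointwise, part 2's `legStep_add'`). -/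
theorem legStepB_add (hK : ∀ n, ∃ δ C : ℝ, 0 < δ ∧ Decays (K n) C δ) (n : ℕ) {W W' : Fin (d + 1) → (Fin (d + 1) → ℤ) → Fin (d + 1) → (Fin (d + 1) → ℤ) → MKer (d + 1) (Fib d)}
    (hW : ∃ B : ℝ, ∀ κ u κ' u' x z a b, |W κ u κ' u' x z a b| ≤ B) (hW' : ∃ B : ℝ, ∀ κ u κ' u' x z a b, |W' κ u κ' u' x z a b| ≤ B) :
    legStepB kc K N n (W + W') = legStepB kc K N n W + legStepB kc K N n W' := by
  obtain ⟨δ, C, hδ, hKn⟩ := hK n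
  obtain ⟨B, hB⟩ := hW
  obtain ⟨B', hB'⟩ := hW'
  funext κ u κ' u'
  have e : (fun κ u κ' u' => bsum N ((W + W') κ u κ' u'))
      = (fun κ u κ' u' => bsum N (W κ u κ' u')) + fun κ u κ' u' => bsum N (W' κ u κ' u') := by
    funext κ u κ' u'
    show bsum N (W κ u κ' u' + W' κ u κ' u') = _
    rw [bsum_add]
    rfl
  show legStep (kc n) (K n) (K n) N (fun κ u κ' u' => bsum N ((W + W') κ u κ' u')) κ u κ' u' = _
  rw [e, legStep_add' hKn hδ hKn hδ (kc n)
    (fun κ u κ' u' x z a b => bdd_bsum N (fun x z a b => hB κ u κ' u' x z a b) x z a b)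
    (fun κ u κ' u' x z a b => bdd_bsum N (fun x z a b => hB' κ u κ' u' x z a b) x z a b)]
  rfl

/-! ## §2 The unrolled tower -/

/-- [folklore] **(REP-leg), THE m-FOLD FORM** (WARD6 (9.1) ∕ R10 (iii), over leaf-01's `AffineUnroll.eq_transport_add_sum`): for a tower of tables whose
right-divergenced members obey the closed one-step law of part 1 at every level (`hstep`, e.g. `Lin4LegTower.rdiv_lin4_affine`), with `T 0` and every source
bounded and every `K n` decaying,
`(fun s ↦ rdiv (T n s)) = transport (legStepB kc K N) 0 n (fun s ↦ rdiv (T 0 s)) + Σ_{m ∈ range n} transport (legStepB kc K N) (m+1) (n−1−m) (fun s ↦ rdiv (F m s))`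
— the initial right-divergenced member pushed through all `n` leg maps plus every level-`m` source divergence pushed from level `m+1` on; NO CROSS TERMS. -/
theorem rdiv_tower_unrolled (hK : ∀ n, ∃ δ C : ℝ, 0 < δ ∧ Decays (K n) C δ)
    {T F : ℕ → Fin (d + 1) → (Fin (d + 1) → ℤ) → Fin (d + 1) → (Fin (d + 1) → ℤ) → MKer (d + 1) (Fib d)}
    (hT0 : ∃ B : ℝ, ∀ κ u κ' u' x z a b, |T 0 κ u κ' u' x z a b| ≤ B) (hF : ∀ n, ∃ B : ℝ, ∀ κ u κ' u' x z a b, |F n κ u κ' u' x z a b| ≤ B)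
    (hstep : ∀ n κ u κ' u', rdiv (T (n + 1) κ u κ' u')
      = legStep (kc n) (K n) (K n) N (fun κ u κ' u' => bsum N (rdiv (T n κ u κ' u'))) κ u κ' u' + rdiv (F n κ u κ' u')) (n : ℕ) :
    (fun κ u κ' u' => rdiv (T n κ u κ' u'))
      = transport (legStepB kc K N) 0 n (fun κ u κ' u' => rdiv (T 0 κ u κ' u'))
        + ∑ m ∈ Finset.range n, transport (legStepB kc K N) (m + 1) (n - 1 - m) (fun κ u κ' u' => rdiv (F m κ u κ' u')) := by
  refine eq_transport_add_sum (A := legStepB kc K N)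
    (P := fun W : Fin (d + 1) → (Fin (d + 1) → ℤ) → Fin (d + 1) → (Fin (d + 1) → ℤ) → MKer (d + 1) (Fib d) => ∃ B : ℝ, ∀ κ u κ' u' x z a b, |W κ u κ' u' x z a b| ≤ B)
    bdd₄_zero (fun _ _ => bdd₄_add) (fun j _ hx => bddTab_legStepB hK j hx)
    (fun j _ _ hx hy => legStepB_add hK j hx hy) (x := fun n => fun κ u κ' u' => rdiv (T n κ u κ' u'))
    (b := fun m => fun κ u κ' u' => rdiv (F m κ u κ' u')) (bddTab_rdiv hT0) (fun m => bddTab_rdiv (hF m)) (fun j => ?_) n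
  funext κ u κ' u'
  rw [hstep j κ u κ' u']
  rfl

/-- [folklore] **THE m-FOLD FORM FROM THE AFFINE RECURSION ITSELF**: if `T (n+1) = lin4 (c n) (K n) N (T n) + F n` with every `K n` decaying and obeying (hH)
(constants `cH n`) and (hM♯), `N ≥ 1`, `T 0` and the sources bounded, then `rdiv_tower_unrolled` holds with `kc n = −(c n · cH n)` (part 1's `rdiv_lin4_affine`
supplies `hstep`; boundedness of every member by leaf-01's `lin4_bdd`). -/
theorem rdiv_tower_unrolled_of_rec {c cH : ℕ → ℝ} (hK : ∀ n, ∃ δ C : ℝ, 0 < δ ∧ Decays (K n) C δ) (hN : 1 ≤ N)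
    {T F : ℕ → Fin (d + 1) → (Fin (d + 1) → ℤ) → Fin (d + 1) → (Fin (d + 1) → ℤ) → MKer (d + 1) (Fib d)}
    (hT0 : ∃ B : ℝ, ∀ κ u κ' u' x z a b, |T 0 κ u κ' u' x z a b| ≤ B) (hF : ∀ n, ∃ B : ℝ, ∀ κ u κ' u' x z a b, |F n κ u κ' u' x z a b| ≤ B)
    (hrec : ∀ n, T (n + 1) = lin4 (c n) (K n) N (T n) + F n)
    (hH : ∀ n (y : Site (d + 1)) (κ : Fin (d + 1)) (u : Site (d + 1)),
      ∑ μ, (colH (K n) N μ (y - unitVec μ) κ u - colH (K n) N μ y κ u) = cH n * gaugeWt N y κ u)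
    (hMf : ∀ n (y x₂ : Site (d + 1)) (ρ : Fin (d + 1)),
      ∑ μ, (K n x₂ ((N : ℤ) • (y - unitVec μ)) (Sum.inr ρ) (Sum.inr μ) - K n x₂ ((N : ℤ) • y) (Sum.inr ρ) (Sum.inr μ)) = 0) (n : ℕ) :
    (fun κ u κ' u' => rdiv (T n κ u κ' u'))
      = transport (legStepB (fun n => -(c n * cH n)) K N) 0 n (fun κ u κ' u' => rdiv (T 0 κ u κ' u'))
        + ∑ m ∈ Finset.range n, transport (legStepB (fun n => -(c n * cH n)) K N) (m + 1) (n - 1 - m) (fun κ u κ' u' => rdiv (F m κ u κ' u')) := by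
  -- every member is bounded (leaf-01's `lin4_bdd` + the source bound), so part 1's one-step law applies at every level
  have hTb : ∀ n, ∃ B : ℝ, ∀ κ u κ' u' x z a b, |T n κ u κ' u' x z a b| ≤ B := by
    intro n
    induction n with
    | zero => exact hT0
    | succ n ih =>
      obtain ⟨δ, C, hδ, hKn⟩ := hK n
      rw [hrec n]
      exact bdd₄_add (Lin4Additive.lin4_bdd hKn hδ (c n) N ih) (hF n)
  refine rdiv_tower_unrolled hK hT0 hF (fun m κ u κ' u' => ?_) n
  obtain ⟨δ, C, hδ, hKm⟩ := hK m
  obtain ⟨B, hB⟩ := hTb m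
  rw [hrec m]
  exact rdiv_lin4_affine hKm hδ hN (c m) hB (hH m) (hMf m) (F m) κ u κ' u'

/-! ## §3 The block sum commutes out of the chain -/

/-- [folklore] Plumbing-free display: the `k`-fold block sum of the position index, `bsumPow N k = bsum N ∘ ⋯ ∘ bsum N` (`k` factors). -/
def bsumPow (N : ℕ) : ℕ → MKer (d + 1) (Fib d) → MKer (d + 1) (Fib d)
  | 0 => id
  | k + 1 => fun F => bsum N (bsumPow N k F)

/-- [folklore] The `k`-fold block sum is ONE block sum of side `N^k` (`N ≥ 1`; part 2's `bsum_mul`). -/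
theorem bsumPow_eq_bsum_pow (hN : 1 ≤ N) (k : ℕ) (F : MKer (d + 1) (Fib d)) : bsumPow N (k + 1) F = bsum (N ^ (k + 1)) F := by
  induction k with
  | zero =>
    show bsum N F = bsum (N ^ 1) F
    rw [pow_one]
  | succ k ih =>
    show bsum N (bsumPow N (k + 1) F) = bsum (N ^ (k + 2)) F
    rw [ih, pow_succ N (k + 1), bsum_mul (Nat.one_le_pow _ _ hN) N F]

/-- [folklore] The `k`-fold block sum of a bounded kernel is bounded. -/
theorem bddTab_bsumPow {W : Fin (d + 1) → (Fin (d + 1) → ℤ) → Fin (d + 1) → (Fin (d + 1) → ℤ) → MKer (d + 1) (Fib d)} (hW : ∃ B : ℝ, ∀ κ u κ' u' x z a b, |W κ u κ' u' x z a b| ≤ B)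
    (k : ℕ) : ∃ B : ℝ, ∀ κ u κ' u' x z a b, |(fun κ u κ' u' => bsumPow N k (W κ u κ' u')) κ u κ' u' x z a b| ≤ B := by
  induction k with
  | zero => exact hW
  | succ k ih =>
    obtain ⟨B, hB⟩ := ih
    exact ⟨_, fun κ u κ' u' x z a b => bdd_bsum N (fun x z a b => hB κ u κ' u' x z a b) x z a b⟩

/-- [folklore] Plumbing `def`: **THE PURE LEG CHAIN** `legChain kc K N m k = 𝓛_{m+k−1} ∘ ⋯ ∘ 𝓛_m` (no block sums). -/
def legChain (kc : ℕ → ℝ) (K : ℕ → MKer (d + 1) (Fib d)) (N : ℕ) (m : ℕ) :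
    ℕ → (Fin (d + 1) → (Fin (d + 1) → ℤ) → Fin (d + 1) → (Fin (d + 1) → ℤ) → MKer (d + 1) (Fib d))
      → (Fin (d + 1) → (Fin (d + 1) → ℤ) → Fin (d + 1) → (Fin (d + 1) → ℤ) → MKer (d + 1) (Fib d))
  | 0 => id
  | k + 1 => fun W => fun κ u κ' u' => legStep (kc (m + k)) (K (m + k)) (K (m + k)) N (legChain kc K N m k W) κ u κ' u'

/-- [folklore] The pure leg chain preserves the bounded class. -/
theorem bddTab_legChain (hK : ∀ n, ∃ δ C : ℝ, 0 < δ ∧ Decays (K n) C δ) (m k : ℕ)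
    {W : Fin (d + 1) → (Fin (d + 1) → ℤ) → Fin (d + 1) → (Fin (d + 1) → ℤ) → MKer (d + 1) (Fib d)} (hW : ∃ B : ℝ, ∀ κ u κ' u' x z a b, |W κ u κ' u' x z a b| ≤ B) :
    ∃ B : ℝ, ∀ κ u κ' u' x z a b, |legChain kc K N m k W κ u κ' u' x z a b| ≤ B := by
  induction k with
  | zero => exact hW
  | succ k ih =>
    obtain ⟨δ, C, hδ, hKn⟩ := hK (m + k)
    obtain ⟨B, hB⟩ := ih
    exact ⟨_, fun κ u κ' u' x z a b => bdd_legStep hKn hδ hKn hδ (kc (m + k)) (N := N) hB κ u κ' u' x z a b⟩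

/-- [folklore] The pure leg chain commutes with ONE block sum of the position index (part 1's `bsum_legStep`, `k` times). -/
theorem legChain_bsum (hK : ∀ n, ∃ δ C : ℝ, 0 < δ ∧ Decays (K n) C δ) (m k : ℕ) (N' : ℕ)
    {W : Fin (d + 1) → (Fin (d + 1) → ℤ) → Fin (d + 1) → (Fin (d + 1) → ℤ) → MKer (d + 1) (Fib d)} (hW : ∃ B : ℝ, ∀ κ u κ' u' x z a b, |W κ u κ' u' x z a b| ≤ B) :
    legChain kc K N m k (fun κ u κ' u' => bsum N' (W κ u κ' u')) = fun κ u κ' u' => bsum N' (legChain kc K N m k W κ u κ' u') := by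
  induction k with
  | zero => rfl
  | succ k ih =>
    obtain ⟨δ, C, hδ, hKn⟩ := hK (m + k)
    obtain ⟨B, hB⟩ := bddTab_legChain (kc := kc) (N := N) hK m k hW
    funext κ u κ' u'
    show legStep (kc (m + k)) (K (m + k)) (K (m + k)) N (legChain kc K N m k fun κ u κ' u' => bsum N' (W κ u κ' u')) κ u κ' u'
      = bsum N' (legStep (kc (m + k)) (K (m + k)) (K (m + k)) N (legChain kc K N m k W) κ u κ' u')
    rw [ih, bsum_legStep hKn hδ hKn hδ (kc (m + k)) N' hB κ u κ' u']

/-- [folklore] **`𝔹` COMMUTES OUT OF THE CHAIN**: on the bounded class, `transport (𝓛 ∘ 𝔹) m k W = (𝓛_{m+k−1} ∘ ⋯ ∘ 𝓛_m) (𝔹^k W)` —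
`transport (legStepB kc K N) m k W = legChain kc K N m k (fun s ↦ bsumPow N k (W s))` (WARD6 (9.1): «`𝓛_j𝔹 ⋯ 𝓛_{i+1}𝔹 = (𝓛_j ⋯ 𝓛_{i+1}) ∘ 𝔹^{(j−i)}`»;
with `bsumPow_eq_bsum_pow` the member enters through the super-block sum of side `N^k`). -/
theorem transport_legStepB_eq (hK : ∀ n, ∃ δ C : ℝ, 0 < δ ∧ Decays (K n) C δ) (m k : ℕ)
    {W : Fin (d + 1) → (Fin (d + 1) → ℤ) → Fin (d + 1) → (Fin (d + 1) → ℤ) → MKer (d + 1) (Fib d)} (hW : ∃ B : ℝ, ∀ κ u κ' u' x z a b, |W κ u κ' u' x z a b| ≤ B) :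
    transport (legStepB kc K N) m k W = legChain kc K N m k (fun κ u κ' u' => bsumPow N k (W κ u κ' u')) := by
  induction k with
  | zero => rfl
  | succ k ih =>
    rw [transport_succ, ih]
    show (fun κ u κ' u' => legStep (kc (m + k)) (K (m + k)) (K (m + k)) N
        (fun κ u κ' u' => bsum N (legChain kc K N m k (fun κ u κ' u' => bsumPow N k (W κ u κ' u')) κ u κ' u')) κ u κ' u') = _
    rw [← legChain_bsum hK m k N (bddTab_bsumPow hW k)]
    rfl

/-! ## §4 The comb ∕ wall instance -/

section Comb

variable {Lc : ℕ} [NeZero Lc] {r : ℕ → Fin (d + 1) → ℕ}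

/-- [folklore] **(REP-leg), THE m-FOLD FORM FOR THE DRESSED COMB TOWER** `K♮ᴱ_n = unitK (sfStep Lc n) (smStep d Lc n) (coDressKBmAt (toSite (r n)) Lc (KInvStep Lc n))`
(in-block roots `r n`, `N = Lc`, couplings `c n`, `kc n = −(c n·(Lc^{d+1})⁻¹)`): the right-divergenced members of `T (n+1) = lin4 (c n) K♮ᴱ_n Lc (T n) + F n` unrolled. -/
theorem rdiv_tower_unrolled_comb (hr : ∀ n, r n ∈ box (d + 1) Lc) (c : ℕ → ℝ)
    {T F : ℕ → Fin (d + 1) → (Fin (d + 1) → ℤ) → Fin (d + 1) → (Fin (d + 1) → ℤ) → MKer (d + 1) (Fib d)}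
    (hT0 : ∃ B : ℝ, ∀ κ u κ' u' x z a b, |T 0 κ u κ' u' x z a b| ≤ B) (hF : ∀ n, ∃ B : ℝ, ∀ κ u κ' u' x z a b, |F n κ u κ' u' x z a b| ≤ B)
    (hrec : ∀ n, T (n + 1) = lin4 (c n) (unitK (sfStep Lc n) (smStep d Lc n) (coDressKBmAt (toSite (r n)) Lc (KInvStep (d := d) Lc n))) Lc (T n) + F n)
    (n : ℕ) :
    (fun κ u κ' u' => rdiv (T n κ u κ' u'))
      = transport (legStepB (fun n => -(c n * ((Lc : ℝ) ^ (d + 1))⁻¹))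
            (fun n => unitK (sfStep Lc n) (smStep d Lc n) (coDressKBmAt (toSite (r n)) Lc (KInvStep (d := d) Lc n))) Lc) 0 n
            (fun κ u κ' u' => rdiv (T 0 κ u κ' u'))
        + ∑ m ∈ Finset.range n, transport (legStepB (fun n => -(c n * ((Lc : ℝ) ^ (d + 1))⁻¹))
            (fun n => unitK (sfStep Lc n) (smStep d Lc n) (coDressKBmAt (toSite (r n)) Lc (KInvStep (d := d) Lc n))) Lc) (m + 1) (n - 1 - m)
            (fun κ u κ' u' => rdiv (F m κ u κ' u')) := by
  have hK : ∀ n, ∃ δ C : ℝ, 0 < δ ∧ Decays (unitK (sfStep Lc n) (smStep d Lc n) (coDressKBmAt (toSite (r n)) Lc (KInvStep (d := d) Lc n))) C δ := by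
    intro n
    obtain ⟨δK, CK, hδK, -, hG⟩ := decays_coDressKBmAt_KInvStep (d := d) (hr n) n
    exact ⟨δK, _, hδK, decays_unitK hG⟩
  exact rdiv_tower_unrolled_of_rec (cH := fun _ => ((Lc : ℝ) ^ (d + 1))⁻¹) hK (one_le_of_neZero Lc) hT0 hF hrec
    (fun n => hH_unitK_comb (hr n) n) (fun n => hM_unitK_comb n) n

end Comb

end Summit.QuantumFields.BalabanUV.Beta.GAN24.Lin4LegTowerUnroll
end
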